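import Mathlib
import Summits.NavierStokesRegularity.NavierStokesRegularity.Theorems.TaoLadderRungTwoFlatCoMovingEnergyCalculus
import HarnessLib

/-!
# Tao ladder, rung 2♭ — the RATE BOUND for the co-moving deviation energy on a block (junk race L8b-1, part 2)
  (helper for item stmt-NavierStokesRegularity-22987 `FlatGapCertificatesV2`, crux K_A♭ of route
  TaoLadderRungTwoFlat; cell harvest/h2-tao-ladder, p1 g21; LADDER §49.3)

For the graded mirror lattice, a template `W`, a deviation `u`, a block of shells `[a, P]` and a geometric weight
`φ_{n+1} = e^θ φ_n` (`θ ≥ 0`):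

* `weightedSource_le_of_weight` — with `|u| ≤ A` and `|W| ≤ M` on shells `a−1 … P+1` and clocks `≤ c̄` on
  `a−1 … P`, the source term of `hasDerivAt_coMovingEnergyOn` obeys
  `Σ_{n=a}^{P} φ_n((T_{n−1}(u) − T_n(u)) + C_n) ≤ 2(1+ε)c̄(A·sinh(θ/2) + M·(3 + e^θ))·Σ_{n=a}^{P} φ_n ½|u_n|² + E`,
  with the EDGE INPUT `E = φ_a|T_{a−1}(u)| + φ_P|T_P(u)| + (1+ε)c̄M(φ_a q_{a−1}² + φ_P p_{P+1}²)` (bottom bond, top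
  bond, and the two cross-term monomials reaching across the ends of the block);
* `weightedSource_le` — the same for the co-moving weight `φ_n = e^{θ(n − n_e)}`, right side in terms of
  `MirrorPulse.coMovingEnergyOn`.

So between edge crossings `dV/dt ≤ −μ_θ V + E` with `μ_θ = σθ − 2(1+ε)c̄(A sinh(θ/2) + M(3+e^θ))` — theory-1's
`σθ − 2 sinh(θ/2)(1+ε)c̄A_u − c_× c̄ κη̂(d₁)` with `c_× = 2(3+e^θ)(1+ε) ≤ 6(1+e^θ)(1+ε)` (JUNK-RACE-49 §49.3); the
integration in time is `…CoMovingEnergyDecay`.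

HONEST FRAMING: an inequality about a MODEL lattice (Tao 2016 §4 vocabulary on `S♭`), kernel-checked; the a-priori
bounds `A, M, c̄` and the block are HYPOTHESES; nothing certified about any orbit; nothing about the Navier–Stokes
equations.
-/

noncomputable section

-- the sub-problem namespace repeats the summit name by design (D-0017)
set_option linter.dupNamespace false

namespace Summit.NavierStokesRegularity.NavierStokesRegularity.Theorems

open Set Filter Literature.Analysis.FluidPDE Literature.Analysis.FluidPDE.TaoCascade
open scoped Topology

namespace MirrorPulse

/-! ### 4. The rate bound on a block `[a, P]` -/

/-- **RATE BOUND, general geometric weight.** For a weight `φ > 0` with `φ_{n+1} = e^θ φ_n` (`θ ≥ 0`), a block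
`[a, P]`, amplitudes `|u| ≤ A` and template `|W| ≤ M` on shells `a−1 … P+1`, clocks `≤ c̄` on `a−1 … P`:
`Σ_{n=a}^{P} φ_n((T_{n−1}(u) − T_n(u)) + C_n) ≤ 2(1+ε)c̄(A sinh(θ/2) + M(3+e^θ))·Σ_{n=a}^{P} φ_n ½|u_n|² + E`,
`E = φ_a|T_{a−1}| + φ_P|T_P| + (1+ε)c̄M(φ_a q_{a−1}² + φ_P p_{P+1}²)`.
[cite: Tao2016AveragedNS, §4 (4.3), (4.8); route TaoLadderRungTwoFlat, L8b-1 (LADDER §49.3)] -/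
theorem weightedSource_le_of_weight {ε ε₀ θ A M cbar : ℝ} (hε : 0 ≤ ε) (hε₀ : -1 ≤ ε₀) (hθ : 0 ≤ θ)
    {a P : ℤ} (haP : a ≤ P) (W u : Fin 2 → ℤ → ℝ → ℝ) (t : ℝ) (φ : ℤ → ℝ) (hφpos : ∀ n, 0 < φ n)
    (hφs : ∀ n, φ (n + 1) = Real.exp θ * φ n)
    (hA : ∀ i, ∀ n ∈ Finset.Icc (a - 1) (P + 1), |u i n t| ≤ A)
    (hM : ∀ i, ∀ n ∈ Finset.Icc (a - 1) (P + 1), |W i n t| ≤ M)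
    (hc : ∀ n ∈ Finset.Icc (a - 1) P, clock ε₀ n ≤ cbar) :
    ∑ n ∈ Finset.Icc a P, φ n *
        ((fluxT ε ε₀ u (n - 1) t - fluxT ε ε₀ u n t)
          + ∑ i : Fin 2, u i n t * QuadPolar.linTermOn shiftSetFlat ε₀ (mirrorTable ε ε) W u i n t)
      ≤ 2 * (1 + ε) * cbar * (A * Real.sinh (θ / 2) + M * (3 + Real.exp θ)) *
            ∑ n ∈ Finset.Icc a P, φ n * ((u 0 n t ^ 2 + u 1 n t ^ 2) / 2)
        + (φ a * |fluxT ε ε₀ u (a - 1) t| + φ P * |fluxT ε ε₀ u P t|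
          + (1 + ε) * cbar * M * (φ a * u 1 (a - 1) t ^ 2 + φ P * u 0 (P + 1) t ^ 2)) := by
  -- weight bookkeeping
  have hφnn : ∀ n, 0 ≤ φ n := fun n => (hφpos n).le
  have hφpred : ∀ n, φ n = Real.exp θ * φ (n - 1) := fun n => by
    have h := hφs (n - 1); rwa [sub_add_cancel] at h
  have hφsucc' : ∀ n, φ n = Real.exp (-θ) * φ (n + 1) := fun n => by
    rw [hφs, Real.exp_neg, ← mul_assoc, inv_mul_cancel₀ (Real.exp_pos θ).ne', one_mul]
  have hmono : ∀ n, φ n ≤ φ (n + 1) := fun n => by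
    rw [hφs]; exact le_mul_of_one_le_left (hφnn n) (Real.one_le_exp hθ)
  have hexp1 : Real.exp (-θ) ≤ Real.exp θ := Real.exp_le_exp.mpr (by linarith)
  -- membership bookkeeping
  have memA : ∀ n, a - 1 ≤ n → n ≤ P + 1 → n ∈ Finset.Icc (a - 1) (P + 1) := fun n h1 h2 =>
    Finset.mem_Icc.mpr ⟨h1, h2⟩
  have memC : ∀ n, a - 1 ≤ n → n ≤ P → n ∈ Finset.Icc (a - 1) P := fun n h1 h2 =>
    Finset.mem_Icc.mpr ⟨h1, h2⟩
  -- basic signs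
  have hA0 : 0 ≤ A := (abs_nonneg _).trans (hA 0 a (memA a (by omega) (by omega)))
  have hM0 : 0 ≤ M := (abs_nonneg _).trans (hM 0 a (memA a (by omega) (by omega)))
  have hcbar : 0 ≤ cbar := (clock_nonneg hε₀ a).trans (hc a (memC a (by omega) haP))
  have hsinh : 0 ≤ Real.sinh (θ / 2) := Real.sinh_nonneg_iff.mpr (by linarith)
  -- the two species sums
  set Sp : ℝ := ∑ n ∈ Finset.Icc a P, φ n * u 0 n t ^ 2 with hSp_def
  set Sq : ℝ := ∑ n ∈ Finset.Icc a P, φ n * u 1 n t ^ 2 with hSq_def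
  have hSp0 : 0 ≤ Sp := Finset.sum_nonneg fun n _ => mul_nonneg (hφnn n) (sq_nonneg _)
  have hSq0 : 0 ≤ Sq := Finset.sum_nonneg fun n _ => mul_nonneg (hφnn n) (sq_nonneg _)
  have hV : ∑ n ∈ Finset.Icc a P, φ n * ((u 0 n t ^ 2 + u 1 n t ^ 2) / 2) = (Sp + Sq) / 2 := by
    rw [hSp_def, hSq_def, ← Finset.sum_add_distrib, Finset.sum_div]
    refine Finset.sum_congr rfl fun n _ => ?_
    ring
  rw [hV]
  -- split the source into flux part SF and cross part SC
  rw [show (∑ n ∈ Finset.Icc a P, φ n *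
        ((fluxT ε ε₀ u (n - 1) t - fluxT ε ε₀ u n t)
          + ∑ i : Fin 2, u i n t * QuadPolar.linTermOn shiftSetFlat ε₀ (mirrorTable ε ε) W u i n t))
      = (∑ n ∈ Finset.Icc a P, φ n * (fluxT ε ε₀ u (n - 1) t - fluxT ε ε₀ u n t))
        + ∑ n ∈ Finset.Icc a P, φ n *
            ∑ i : Fin 2, u i n t * QuadPolar.linTermOn shiftSetFlat ε₀ (mirrorTable ε ε) W u i n t by
    rw [← Finset.sum_add_distrib]
    exact Finset.sum_congr rfl fun n _ => mul_add _ _ _]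
  ------------------------------------------------------------------
  -- (I) the flux part
  ------------------------------------------------------------------
  have habel := abel_sum_Icc φ (fun k => fluxT ε ε₀ u k t) haP
  have hSF : ∑ n ∈ Finset.Icc a P, φ n * (fluxT ε ε₀ u (n - 1) t - fluxT ε ε₀ u n t)
      ≤ φ a * |fluxT ε ε₀ u (a - 1) t| + φ P * |fluxT ε ε₀ u P t|
        + (1 + ε) * A * cbar * Real.sinh (θ / 2) * (Sq + Sp) := by
    rw [habel]
    -- edge terms
    have e1 : φ a * fluxT ε ε₀ u (a - 1) t ≤ φ a * |fluxT ε ε₀ u (a - 1) t| :=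
      mul_le_mul_of_nonneg_left (le_abs_self _) (hφnn a)
    have e2 : -(φ P * fluxT ε ε₀ u P t) ≤ φ P * |fluxT ε ε₀ u P t| := by
      rw [← mul_neg]; exact mul_le_mul_of_nonneg_left (neg_le_abs _) (hφnn P)
    -- interior bonds
    have e3 : ∑ n ∈ Finset.Ico a P, (φ (n + 1) - φ n) * fluxT ε ε₀ u n t
        ≤ ∑ n ∈ Finset.Ico a P, (1 + ε) * A * cbar * Real.sinh (θ / 2) *
            (φ n * u 1 n t ^ 2 + φ (n + 1) * u 0 (n + 1) t ^ 2) := by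
      refine Finset.sum_le_sum fun n hn => ?_
      have hn' := Finset.mem_Ico.mp hn
      -- the bond step of `weighted_flux_bond`, redone for the abstract weight `φ`
      have hT := abs_fluxT_le hε hε₀ u n t (hA 1 n (memA n (by omega) (by omega)))
        (hA 0 (n + 1) (memA (n + 1) (by omega) (by omega)))
      have hag := weighted_amgm hθ (u 1 n t) (u 0 (n + 1) t)
      have hcn : 0 ≤ clock ε₀ n := clock_nonneg hε₀ n
      have hφn0 : 0 ≤ φ n := hφnn n
      have he1 : 0 ≤ Real.exp θ - 1 := by linarith [Real.one_le_exp hθ]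
      calc (φ (n + 1) - φ n) * fluxT ε ε₀ u n t
          ≤ (φ (n + 1) - φ n) * |fluxT ε ε₀ u n t| :=
            mul_le_mul_of_nonneg_left (le_abs_self _) (by linarith [hmono n])
        _ = φ n * (Real.exp θ - 1) * |fluxT ε ε₀ u n t| := by rw [hφs n]; ring
        _ ≤ φ n * (Real.exp θ - 1) * (clock ε₀ n * ((1 + ε) * A) * (|u 1 n t| * |u 0 (n + 1) t|)) :=
            mul_le_mul_of_nonneg_left hT (mul_nonneg (hφnn n) he1)
        _ = φ n * (clock ε₀ n * ((1 + ε) * A)) * ((Real.exp θ - 1) * (|u 1 n t| * |u 0 (n + 1) t|)) := by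
            ring
        _ ≤ φ n * (clock ε₀ n * ((1 + ε) * A)) *
              (Real.sinh (θ / 2) * (u 1 n t ^ 2 + Real.exp θ * u 0 (n + 1) t ^ 2)) :=
            mul_le_mul_of_nonneg_left hag (by positivity)
        _ ≤ φ n * (cbar * ((1 + ε) * A)) *
              (Real.sinh (θ / 2) * (u 1 n t ^ 2 + Real.exp θ * u 0 (n + 1) t ^ 2)) := by
            have h2 : 0 ≤ Real.sinh (θ / 2) * (u 1 n t ^ 2 + Real.exp θ * u 0 (n + 1) t ^ 2) := by
              positivity
            have := hc n (memC n (by omega) (by omega))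
            gcongr
        _ = (1 + ε) * A * cbar * Real.sinh (θ / 2) * (φ n * u 1 n t ^ 2 + φ (n + 1) * u 0 (n + 1) t ^ 2) := by
            rw [hφs n]; ring
    have e4 : ∑ n ∈ Finset.Ico a P, (1 + ε) * A * cbar * Real.sinh (θ / 2) *
            (φ n * u 1 n t ^ 2 + φ (n + 1) * u 0 (n + 1) t ^ 2)
        = (1 + ε) * A * cbar * Real.sinh (θ / 2) *
            ((∑ n ∈ Finset.Ico a P, φ n * u 1 n t ^ 2)
              + ∑ n ∈ Finset.Ico a P, φ (n + 1) * u 0 (n + 1) t ^ 2) := by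
      rw [← Finset.mul_sum, Finset.sum_add_distrib]
    -- compare the two interior sums with Sq, Sp
    have e5 : ∑ n ∈ Finset.Ico a P, φ n * u 1 n t ^ 2 ≤ Sq :=
      Finset.sum_le_sum_of_subset_of_nonneg Finset.Ico_subset_Icc_self
        fun n _ _ => mul_nonneg (hφnn n) (sq_nonneg _)
    have e6 : ∑ n ∈ Finset.Ico a P, φ (n + 1) * u 0 (n + 1) t ^ 2 ≤ Sp := by
      rw [sum_Ico_add_shift (fun m => φ m * u 0 m t ^ 2) a P 1]
      refine Finset.sum_le_sum_of_subset_of_nonneg ?_ fun n _ _ => mul_nonneg (hφnn n) (sq_nonneg _)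
      intro m hm
      rw [Finset.mem_Ico] at hm
      exact Finset.mem_Icc.mpr ⟨by omega, by omega⟩
    have hK1 : 0 ≤ (1 + ε) * A * cbar * Real.sinh (θ / 2) := by positivity
    have e7 := mul_le_mul_of_nonneg_left (add_le_add e5 e6) hK1
    linarith [e1, e2, e3, e4, e7]
  ------------------------------------------------------------------
  -- (II) the cross part
  ------------------------------------------------------------------
  have hSC : ∑ n ∈ Finset.Icc a P, φ n *
          ∑ i : Fin 2, u i n t * QuadPolar.linTermOn shiftSetFlat ε₀ (mirrorTable ε ε) W u i n t
      ≤ (1 + ε) * cbar * M * ((3 + Real.exp θ) * (Sp + Sq)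
          + (φ a * u 1 (a - 1) t ^ 2 + φ P * u 0 (P + 1) t ^ 2)) := by
    -- pointwise
    have c1 : ∑ n ∈ Finset.Icc a P, φ n *
          ∑ i : Fin 2, u i n t * QuadPolar.linTermOn shiftSetFlat ε₀ (mirrorTable ε ε) W u i n t
        ≤ ∑ n ∈ Finset.Icc a P, φ n * ((1 + ε) * cbar * M *
            (3 * u 0 n t ^ 2 + 3 * u 1 n t ^ 2 + u 1 (n - 1) t ^ 2 + u 0 (n + 1) t ^ 2)) := by
      refine Finset.sum_le_sum fun n hn => ?_
      have hn' := Finset.mem_Icc.mp hn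
      refine mul_le_mul_of_nonneg_left ?_ (hφnn n)
      exact cross_term_le hε hε₀ W u n t
        (fun i => hM i (n - 1) (memA (n - 1) (by omega) (by omega)))
        (fun i => hM i n (memA n (by omega) (by omega)))
        (fun i => hM i (n + 1) (memA (n + 1) (by omega) (by omega)))
        (hc (n - 1) (memC (n - 1) (by omega) (by omega))) (hc n (memC n (by omega) (by omega)))
    have c2 : ∑ n ∈ Finset.Icc a P, φ n * ((1 + ε) * cbar * M *
            (3 * u 0 n t ^ 2 + 3 * u 1 n t ^ 2 + u 1 (n - 1) t ^ 2 + u 0 (n + 1) t ^ 2))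
        = (1 + ε) * cbar * M * (3 * Sp + 3 * Sq
            + (∑ n ∈ Finset.Icc a P, φ n * u 1 (n - 1) t ^ 2)
            + ∑ n ∈ Finset.Icc a P, φ n * u 0 (n + 1) t ^ 2) := by
      rw [hSp_def, hSq_def, Finset.mul_sum, Finset.mul_sum, ← Finset.sum_add_distrib,
        ← Finset.sum_add_distrib, ← Finset.sum_add_distrib, Finset.mul_sum]
      refine Finset.sum_congr rfl fun n _ => ?_
      ring
    -- the behind-shifted sum: Σ φ_n q_{n-1}² = e^θ Σ_{[a-1,P-1]} φ_m q_m² ≤ e^θ (φ_{a-1} q_{a-1}² + Sq)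
    have c3 : ∑ n ∈ Finset.Icc a P, φ n * u 1 (n - 1) t ^ 2
        ≤ φ a * u 1 (a - 1) t ^ 2 + Real.exp θ * Sq := by
      have hre : ∑ n ∈ Finset.Icc a P, φ n * u 1 (n - 1) t ^ 2
          = Real.exp θ * ∑ m ∈ Finset.Icc (a - 1) (P - 1), φ m * u 1 m t ^ 2 := by
        rw [Finset.mul_sum]
        have hs := sum_Icc_add_shift (fun m => Real.exp θ * (φ m * u 1 m t ^ 2)) a P (-1)
        simp only [← sub_eq_add_neg] at hs
        rw [← hs]
        refine Finset.sum_congr rfl fun n _ => ?_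
        rw [hφpred n]; ring
      have hsub : ∑ m ∈ Finset.Icc (a - 1) (P - 1), φ m * u 1 m t ^ 2
          ≤ ∑ m ∈ Finset.Icc (a - 1) P, φ m * u 1 m t ^ 2 :=
        Finset.sum_le_sum_of_subset_of_nonneg (Finset.Icc_subset_Icc le_rfl (by omega))
          fun n _ _ => mul_nonneg (hφnn n) (sq_nonneg _)
      have hins : Finset.Icc (a - 1) P = insert (a - 1) (Finset.Icc a P) := by
        rw [← Finset.insert_Icc_add_one_left_eq_Icc (show a - 1 ≤ P by omega), sub_add_cancel]
      have hnot : a - 1 ∉ Finset.Icc a P := by simp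
      rw [hins, Finset.sum_insert hnot] at hsub
      rw [hre]
      have hφa : Real.exp θ * (φ (a - 1) * u 1 (a - 1) t ^ 2) = φ a * u 1 (a - 1) t ^ 2 := by
        rw [hφpred a]; ring
      calc Real.exp θ * ∑ m ∈ Finset.Icc (a - 1) (P - 1), φ m * u 1 m t ^ 2
          ≤ Real.exp θ * (φ (a - 1) * u 1 (a - 1) t ^ 2 + Sq) :=
            mul_le_mul_of_nonneg_left hsub (Real.exp_pos θ).le
        _ = φ a * u 1 (a - 1) t ^ 2 + Real.exp θ * Sq := by rw [mul_add, hφa]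
    -- the ahead-shifted sum: Σ φ_n p_{n+1}² = e^{-θ} Σ_{[a+1,P+1]} φ_m p_m² ≤ e^{-θ} (Sp + φ_{P+1} p_{P+1}²)
    have c4 : ∑ n ∈ Finset.Icc a P, φ n * u 0 (n + 1) t ^ 2
        ≤ Real.exp (-θ) * Sp + φ P * u 0 (P + 1) t ^ 2 := by
      have hre : ∑ n ∈ Finset.Icc a P, φ n * u 0 (n + 1) t ^ 2
          = Real.exp (-θ) * ∑ m ∈ Finset.Icc (a + 1) (P + 1), φ m * u 0 m t ^ 2 := by
        rw [Finset.mul_sum, ← sum_Icc_add_shift (fun m => Real.exp (-θ) * (φ m * u 0 m t ^ 2)) a P 1]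
        refine Finset.sum_congr rfl fun n _ => ?_
        rw [hφsucc' n]; ring
      have hsub : ∑ m ∈ Finset.Icc (a + 1) (P + 1), φ m * u 0 m t ^ 2
          ≤ ∑ m ∈ Finset.Icc a (P + 1), φ m * u 0 m t ^ 2 :=
        Finset.sum_le_sum_of_subset_of_nonneg (Finset.Icc_subset_Icc (by omega) le_rfl)
          fun n _ _ => mul_nonneg (hφnn n) (sq_nonneg _)
      have hins : Finset.Icc a (P + 1) = insert (P + 1) (Finset.Icc a P) := by
        rw [Finset.insert_Icc_right_eq_Icc_add_one (show a ≤ P + 1 by omega)]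
      have hnot : P + 1 ∉ Finset.Icc a P := by simp
      rw [hins, Finset.sum_insert hnot] at hsub
      rw [hre]
      have hφP : Real.exp (-θ) * (φ (P + 1) * u 0 (P + 1) t ^ 2) = φ P * u 0 (P + 1) t ^ 2 := by
        rw [hφsucc' P]; ring
      calc Real.exp (-θ) * ∑ m ∈ Finset.Icc (a + 1) (P + 1), φ m * u 0 m t ^ 2
          ≤ Real.exp (-θ) * (φ (P + 1) * u 0 (P + 1) t ^ 2 + Sp) :=
            mul_le_mul_of_nonneg_left hsub (Real.exp_pos _).le
        _ = Real.exp (-θ) * Sp + φ P * u 0 (P + 1) t ^ 2 := by rw [mul_add, hφP, add_comm]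
    -- assemble: e^{-θ} Sp + e^{θ} Sq ≤ e^θ (Sp + Sq)
    have c5 : Real.exp (-θ) * Sp ≤ Real.exp θ * Sp := mul_le_mul_of_nonneg_right hexp1 hSp0
    have hK2 : 0 ≤ (1 + ε) * cbar * M := by positivity
    have c6 : 3 * Sp + 3 * Sq + (∑ n ∈ Finset.Icc a P, φ n * u 1 (n - 1) t ^ 2)
          + ∑ n ∈ Finset.Icc a P, φ n * u 0 (n + 1) t ^ 2
        ≤ (3 + Real.exp θ) * (Sp + Sq) + (φ a * u 1 (a - 1) t ^ 2 + φ P * u 0 (P + 1) t ^ 2) := by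
      nlinarith [c3, c4, c5]
    calc _ ≤ _ := c1
      _ = _ := c2
      _ ≤ _ := mul_le_mul_of_nonneg_left c6 hK2
  ------------------------------------------------------------------
  -- (III) assemble
  ------------------------------------------------------------------
  have hfinal : (1 + ε) * A * cbar * Real.sinh (θ / 2) * (Sq + Sp)
        + (1 + ε) * cbar * M * ((3 + Real.exp θ) * (Sp + Sq))
      = 2 * (1 + ε) * cbar * (A * Real.sinh (θ / 2) + M * (3 + Real.exp θ)) * ((Sp + Sq) / 2) := by
    ring
  nlinarith [hSF, hSC, hfinal]

/-- **RATE BOUND for the co-moving energy.** Specialisation of `weightedSource_le_of_weight` to the co-moving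
weight `φ_n = e^{θ(n − n_e)}`: the source term of `hasDerivAt_coMovingEnergyOn` on the block `[a,P]` is at most
`2(1+ε)c̄(A sinh(θ/2) + M(3+e^θ))·V_{[a,P]} + E` with the edge input
`E = φ_a|T_{a−1}(u)| + φ_P|T_P(u)| + (1+ε)c̄M(φ_a q_{a−1}² + φ_P p_{P+1}²)`.
[cite: Tao2016AveragedNS, §4 (4.3), (4.8); route TaoLadderRungTwoFlat, L8b-1 (LADDER §49.3)] -/
theorem weightedSource_le {ε ε₀ θ A M cbar : ℝ} (hε : 0 ≤ ε) (hε₀ : -1 ≤ ε₀) (hθ : 0 ≤ θ)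
    {a P : ℤ} (haP : a ≤ P) (W u : Fin 2 → ℤ → ℝ → ℝ) (t ne : ℝ)
    (hA : ∀ i, ∀ n ∈ Finset.Icc (a - 1) (P + 1), |u i n t| ≤ A)
    (hM : ∀ i, ∀ n ∈ Finset.Icc (a - 1) (P + 1), |W i n t| ≤ M)
    (hc : ∀ n ∈ Finset.Icc (a - 1) P, clock ε₀ n ≤ cbar) :
    ∑ n ∈ Finset.Icc a P, Real.exp (θ * ((n : ℝ) - ne)) *
        ((fluxT ε ε₀ u (n - 1) t - fluxT ε ε₀ u n t)
          + ∑ i : Fin 2, u i n t * QuadPolar.linTermOn shiftSetFlat ε₀ (mirrorTable ε ε) W u i n t)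
      ≤ 2 * (1 + ε) * cbar * (A * Real.sinh (θ / 2) + M * (3 + Real.exp θ)) *
            coMovingEnergyOn (Finset.Icc a P) θ ne u t
        + (Real.exp (θ * ((a : ℝ) - ne)) * |fluxT ε ε₀ u (a - 1) t|
          + Real.exp (θ * ((P : ℝ) - ne)) * |fluxT ε ε₀ u P t|
          + (1 + ε) * cbar * M * (Real.exp (θ * ((a : ℝ) - ne)) * u 1 (a - 1) t ^ 2
              + Real.exp (θ * ((P : ℝ) - ne)) * u 0 (P + 1) t ^ 2)) := by
  have h := weightedSource_le_of_weight hε hε₀ hθ haP W u t (fun n : ℤ => Real.exp (θ * ((n : ℝ) - ne)))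
    (fun n => Real.exp_pos _) (fun n => comovingWeight_succ θ ne n) hA hM hc
  unfold coMovingEnergyOn
  simpa only using h

end MirrorPulse

end Summit.NavierStokesRegularity.NavierStokesRegularity.Theorems

end
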